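import Summits.ABC.IUTFork.LanaLogTheta
import Summits.ABC.IUTFork.LanaEtaAlgorithm
import Summits.ABC.IUTFork.LanaRssBridge
import HarnessLib

/-!
# L-LANA objects XIII: the §8.1 procedure (a)–(i) on the big-H diagram, assembled over the real L-LANA objects

Record-only file (D-0012) of the abc-iut cell (seat abc-iut-c312-4, L-LANA level; the assembly of N12/N14/
N15/N16 — the LANA-level analogue of skel XVI `ForkSwitch.LanaModel`, but over the constructed objects of
`LanaLogTheta` / `LanaEtaAlgorithm` / `LanaRss`); TAKES NO SIDE on [IUTchIII] Cor. 3.12. Project LANA's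
interim report (bib `LANA2026Report`, read on the page), §8.1 pp. 40–41, lists the procedure:
(a) "We start from the `q`-pilot BPS inside `¹'⁰HT`. The procession-normalized log-volume of the `q`-pilot
object `−|log(q)| ∈ ℝ` is computed in the usual way"; (b) "The Θ-link glues the rigidified `q`-pilot BPS on the
right-hand side full poly-isomorphically to the Θ-pilot BPS on the left-hand side"; (c) "Apply the
multiradial algorithm of Theorem 3.11 … regions `{⁰'⁰U_λ}_λ` of possible images of the Θ-pilot object are
obtained"; (d) "under the Θ-link, the unit group portions `⁰'⁰O^{×μ}_v` and `¹'⁰O^{×μ}_v` are identified";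
(e) "reading through the log-Kummer correspondence"; (f) "one takes the holomorphic hull"; (g) the ladder
"for every integer `m`"; (h) "The value log-vol(`(U^{hol})^{det}`) is `−|log(Θ)|`"; (i) "Attempt to reach a
conclusion. Mochizuki asserts that, by properties of the algorithm itself such as (IPL), (SHE), and (APT) …
one can construct a proof that obtains the inequality of Corollary 3.12 `−|log(q)| ≤ −|log(Θ)|` (8-1)".

* `LanaProcedure` — ONE structure holding the typed counterparts: (b),(d),(g) a `BigH` (two log sequences,
  a Θ-link at every level, unit identifications — `LanaLogTheta`); (c) a Θ-value-action signature `EtaSteps`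
  at every place WITH the p. 36 containment as hypothesis field (`LanaEtaAlgorithm`); (a),(e),(f),(h) an
  `EtaData` in a measure space standing for `VC(¹'¹I)` — the `q`-region, the output regions `LGP·S`, the
  suitable `S` ((Ind1–3)), the hull — with `SuitableInHull` ((f): the hull is of the union) (`LanaRss`).
* `LanaProcedure.Cor312` := (8-1) at measure level; `LanaProcedure.MainGoal` := LANA (9-1) for its
  `η`-datum. PROVED: `cor312_of_mainGoal` ((9-1) ⟹ (8-1): LANA p. 44 "We believe that if the problem
  described in the "main goal" below is solved, then Corollary 3.12 … will follow" is a THEOREM at the typed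
  level), `cor312_iff_skel` (= VIII `Cor312` of the carried `OutputRegions`), `unitIdentification_nonempty`
  ((d) is available at every level: the gluing is nonempty).
* (i) is NOT a theorem here: (IPL)/(SHE)/(APT) are not typable (LLANA-SPEC N17; recorded in
  `LanaThetaLink.ThetaLink`); what the assembled types require beyond the constructed data to reach (8-1)
  is exactly `MainGoal` — `mainGoal_is_the_extra_input` (cf. skel XII `represented_is_the_extra_input`).

[cite: LANA2026Report, §8.1 (a)–(i) pp. 40–41, §8.3 p. 43, §9 p. 44, §9.2 (9-1) p. 46] NOT here: any judgement.
-/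

noncomputable section

open MeasureTheory

namespace Summit.ABC
namespace IUTFork

variable {V : Type} (ref : V → RefLocalDatum) [Fintype V] (bad : Finset V)
  {Ω : Type} [MeasurableSpace Ω] (μ : Measure Ω)

/-- **LANA §8.1, the procedure on the big-H diagram, assembled** (see the module docstring for the
step-by-step dictionary (a)–(i) ↔ fields). All fields are the REAL L-LANA objects; the hypotheses carried are
exactly: the p. 36 containment at each place ((c), Thm. 3.11 (ii) content) and "the hull is taken of the union
of the possible image regions" ((f)). [cite: LANA2026Report, §8.1 pp. 40–41] -/
structure LanaProcedure : Type 1 where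
  /-- (b),(d),(g): two log sequences and a Θ-link at every level -/
  bigH : BigH ref bad
  /-- (c): the Θ-value-action construction (Thm. 3.11's algorithm, Fig. 3) at each place -/
  eta : V → EtaSteps
  /-- (c), hypothesis: the p. 36 containment `Im ψ_v ⊆ Im φ_v` at each place -/
  containment : ∀ v, (eta v).Containment
  /-- (a),(e),(f),(h): the `η`-datum in the volume container `VC(¹'¹I)` -/
  E : EtaData μ
  /-- (f): every suitable output region lies in the hull region -/
  suitableInHull : E.SuitableInHull

namespace LanaProcedure

variable {ref bad μ} (P : LanaProcedure ref bad μ)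

/-- (a): `−|log(q)|`, "computed in the usual way in the right-hand column" = log-volume of the `q`-region.
[cite: LANA2026Report, §8.1 (a) p. 40] -/
def negAbsLogq : ℝ := P.E.negAbsLogq

/-- (h): `−|log(Θ)| = log-vol((U^{hol})^{det})` = log-volume of the hull region. [cite: LANA2026Report, §8.1 (h) p. 41] -/
def negAbsLogTheta : ℝ := P.E.negAbsLogTheta

/-- **(8-1)**, the inequality of Cor. 3.12 at measure level: `−|log(q)| ≤ −|log(Θ)|`. A `Prop`; never
asserted. [cite: LANA2026Report, §8.1 (8-1) p. 41] -/
@[cite "LANA2026Report" "§8.1 (8-1) p. 41"]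
def Cor312 : Prop := P.negAbsLogq ≤ P.negAbsLogTheta

/-- **(9-1)** for the procedure's `η`-datum ("there exists some suitable `S` such that `η_q = η^{anab}_S`").
HYPOTHESIS. [cite: LANA2026Report, §9.2 (9-1) p. 46] -/
@[cite "LANA2026Report" "§9.2 (9-1) p. 46"]
def MainGoal : Prop := P.E.MainGoal

/-- **(9-1) ⟹ (8-1)** (LANA p. 44 "if the problem described in the "main goal" below is solved, then
Corollary 3.12 … will follow" — a theorem at the typed level: `EtaData.cor312_of_mainGoal`, measure
monotonicity + (f)). [cite: LANA2026Report, §9 p. 44, §8.3 p. 43] -/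
theorem cor312_of_mainGoal (h : P.MainGoal) : P.Cor312 := P.E.cor312_of_mainGoal P.suitableInHull h

/-- (8-1) here IS skel VIII's `Cor312` for the `OutputRegions` carried by the `η`-datum (`LanaRssBridge`).
[cite: LANA2026Report, §8.1 (8-1) p. 41] -/
theorem cor312_iff_skel : P.Cor312 ↔ (P.E.toOutputRegions P.suitableInHull).Cor312 :=
  (P.E.cor312_iff P.suitableInHull).symm

/-- (9-1) here IS skel VIII's `Represented` for the carried `OutputRegions`. [cite: LANA2026Report, §9.3 p. 46] -/
theorem mainGoal_iff_represented : P.MainGoal ↔ (P.E.toOutputRegions P.suitableInHull).Represented :=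
  P.E.mainGoal_iff_represented P.suitableInHull

/-- (d) is available at every level `m`: the Θ-link's gluing is nonempty, so a unit identification
`B(⁰'ᵐHT) ⥲ B(¹'ᵐHT)` exists (Rem. 8.2.1). [cite: LANA2026Report, §8.1 (d) p. 40] -/
theorem unitIdentification_nonempty (m : ℤ) :
    Nonempty ((P.bigH.left.HT m).unitBPS.Iso (P.bigH.right.HT m).unitBPS) :=
  (P.bigH.thetaLink_gluing_nonempty m).elim fun Φ hΦ => ⟨P.bigH.unitIdentification m ⟨Φ, hΦ⟩⟩

/-- (c) in factorised form at each place: under the carried containment and injective local Kummer maps,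
`ψ_v` factors (uniquely) through `∏_t O^▷_{v,t}` (`LanaEtaAlgorithm`). [cite: LANA2026Report, §9.1 (f) p. 45] -/
theorem factors_of_injective (v : V) (hκ : ∀ t, Function.Injective ((P.eta v).kappa t)) : (P.eta v).Factors :=
  ((P.eta v).containment_iff_factors hκ).mp (P.containment v)

/-- **(i), what the types say**: (IPL)/(SHE)/(APT) are not typable (N17); over the assembled REAL data the
inequality (8-1) follows from (9-1) (`cor312_of_mainGoal`) and — at the level of log-volumes — (9-1) is
EQUIVALENT to "`−|log(q)|` is one of the possible values" (VIII `Represented`), which (8-1) does NOT force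
(VIII `cor312_not_imp_represented`). So the extra input the procedure needs at step (i) is exactly LANA's
(9-1) (cf. skel XII `represented_is_the_extra_input`). [cite: LANA2026Report, §8.1 (i) p. 41, §8.3 p. 43] -/
theorem mainGoal_is_the_extra_input :
    (P.MainGoal → P.Cor312) ∧ (P.MainGoal ↔ (P.E.toOutputRegions P.suitableInHull).Represented) :=
  ⟨P.cor312_of_mainGoal, P.mainGoal_iff_represented⟩

end LanaProcedure

end IUTFork

end Summit.ABC

end
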